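import Literature.NumberTheory.Automorphic.ArchParameterUnique
import Literature.NumberTheory.Automorphic.AutomorphicRepsGL
import Mathlib.LinearAlgebra.Matrix.ConjTranspose
import HarnessLib

/-!
# Crux `RegularTwistCM` (stmt-Langlands-14069), line `petersson-hermitian-purity`, transfer stub T
# `stub_localPairingTransfer`

The glue of the lead's skeleton: the statements of the stubs C1 (`stub_pairingCore`: two commuting
`𝔤𝔩₂(ℂ)`-actions with Casimir scalars and an integrable twisted diagonal admit an integral pairing), C2
(`stub_complexFactorCasimir`: the complex-place dictionary `ρ = L + R ∘ conj` for a real `𝔤𝔩₂(ℂ)`-module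
with `HasHCParameter`) and C3 (`stub_compactPlaceIntegrality`: `𝔲(n)`-finiteness and torus integrality
of `W / W'` at a complex place), taken VERBATIM as hypotheses, give the local integral pairing of the
archimedean parameter `χ` of a rank-2 automorphic datum `π` at a complex place `w`:
`χ(σ_w) = {a₁, a₂}`, `χ(σ̄_w) = {b₁, b₂}` with `a₁ - b₁, a₂ - b₂ ∈ ℤ` (Clozel 1990, §3.3, the pairing
of the "type à l'infini" at a complex place).

Proof: unfold `AutomorphicRepData.HasArchParameter` at `w` to a real Lie algebra map
`ρ_w : 𝔤𝔩₂(ℂ) → End (W / W')` with `HasHCParameter ρ_w (τ ↦ χ(τ ∘ σ_w))`; factor it by C2; on a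
skew-Hermitian `Y` one has `Ȳ = -Yᵀ`, so `ρ_w Y = L Y - R Yᵀ` and `ρ_w (i E_{jj}) = i (L E_{jj} - R E_{jj})`,
whence the finiteness/integrality hypotheses of C1 from C3; `W / W' ≠ 0` (`nontrivial_quot`).
-/

set_option linter.dupNamespace false

-- Mathlib idiom (Mathlib/Algebra/Lie/OfAssociative.lean), as in the skeleton and `HarishChandraGL`:
-- commutator brackets on `Matrix (Fin 2) (Fin 2) ℂ` and on `Module.End ℂ V`.
attribute [local instance 100] LieRing.ofAssociativeRing

noncomputable section

open scoped ComplexConjugate Classical Matrix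
open NumberField NumberField.InfinitePlace NumberField.mixedEmbedding
open Literature.NumberTheory.Automorphic

namespace Summit.Langlands.Langlands.Theorems.RegularTwistCM

/-- For a skew-Hermitian complex matrix, entrywise conjugation is `-Yᵀ`. [folklore] -/
theorem map_conj_eq_neg_transpose_of_skew {n : ℕ} {Y : Matrix (Fin n) (Fin n) ℂ} (hY : Yᴴ = -Y) :
    Y.map (starRingEnd ℂ) = -Yᵀ := by
  have h : Y.map (starRingEnd ℂ) = Yᴴᵀ := by
    rw [Matrix.conjTranspose, Matrix.transpose_map, Matrix.transpose_transpose]; rfl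
  rw [h, hY, Matrix.transpose_neg]

-- the Borel–Jacquet carriers (`AutomorphyDatum.gl`, `W / W'`, `𝔤𝔩ₙ(K_∞)`) are large terms: rewriting the
-- restriction `ρ_w` inside hypotheses exceeds the default budget (as in `ClozelPurityProofs`)
set_option maxHeartbeats 400000 in
/-- T (transfer stub: the statements of C1, C2 and C3 (at `n = 2`), taken verbatim as hypotheses, give the
local integral pairing of the archimedean parameter of a rank-2 automorphic datum at a complex place):
unfold `HasArchParameter` at `w`, factor `ρ_w = L + R ∘ conj` (C2), read `ρ_w` on `𝔲(2)` as the twisted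
diagonal `L(Y) - R(Yᵀ)` (`Ȳ = -Yᵀ`), feed local finiteness and integrality (C3) to C1.
[cite: Clozel1990, §3.3] -/
theorem stub_localPairingTransfer
    (hC1 : ∀ {V : Type} [AddCommGroup V] [Module ℂ V] [Nontrivial V]
      (L R : Matrix (Fin 2) (Fin 2) ℂ →ₗ⁅ℂ⁆ Module.End ℂ V),
      (∀ X Y : Matrix (Fin 2) (Fin 2) ℂ, L X * R Y = R Y * L X) →
      ∀ (s₁ s₂ t₁ t₂ : ℂ),
      L 1 = (s₁ + s₂) • (1 : Module.End ℂ V) →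
      ∑ a : Fin 2, ∑ b : Fin 2, L (Matrix.single a b 1) * L (Matrix.single b a 1) =
        (s₁ ^ 2 + s₂ ^ 2 - 1 / 2) • (1 : Module.End ℂ V) →
      R 1 = (t₁ + t₂) • (1 : Module.End ℂ V) →
      ∑ a : Fin 2, ∑ b : Fin 2, R (Matrix.single a b 1) * R (Matrix.single b a 1) =
        (t₁ ^ 2 + t₂ ^ 2 - 1 / 2) • (1 : Module.End ℂ V) →
      (∀ v : V, ∃ F : Submodule ℂ V, v ∈ F ∧ FiniteDimensional ℂ F ∧
        ∀ Y : Matrix (Fin 2) (Fin 2) ℂ, Yᴴ = -Y → ∀ x ∈ F, (L Y - R Yᵀ) x ∈ F) →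
      (∀ (j : Fin 2) (μ : ℂ) (v : V), v ≠ 0 →
        (L (Matrix.single j j 1) - R (Matrix.single j j 1)) v = μ • v → ∃ k : ℤ, μ = k) →
      (∃ k l : ℤ, s₁ - t₁ = k ∧ s₂ - t₂ = l) ∨ (∃ k l : ℤ, s₁ - t₂ = k ∧ s₂ - t₁ = l))
    (hC2 : ∀ {V : Type} [AddCommGroup V] [Module ℂ V]
      (ρ : Matrix (Fin 2) (Fin 2) ℂ →ₗ⁅ℝ⁆ Module.End ℂ V) (χ : (ℂ →ₐ[ℝ] ℂ) → Multiset ℂ),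
      HasHCParameter ρ χ →
      ∃ L R : Matrix (Fin 2) (Fin 2) ℂ →ₗ⁅ℂ⁆ Module.End ℂ V,
        (∀ X Y : Matrix (Fin 2) (Fin 2) ℂ, L X * R Y = R Y * L X) ∧
        (∀ X : Matrix (Fin 2) (Fin 2) ℂ, ρ X = L X + R (X.map (starRingEnd ℂ))) ∧
        (∀ s₁ s₂ : ℂ, χ (AlgHom.id ℝ ℂ) = {s₁, s₂} →
          L 1 = (s₁ + s₂) • (1 : Module.End ℂ V) ∧
          ∑ a : Fin 2, ∑ b : Fin 2, L (Matrix.single a b 1) * L (Matrix.single b a 1) =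
            (s₁ ^ 2 + s₂ ^ 2 - 1 / 2) • (1 : Module.End ℂ V)) ∧
        (∀ t₁ t₂ : ℂ, χ (Complex.conjAe : ℂ →ₐ[ℝ] ℂ) = {t₁, t₂} →
          R 1 = (t₁ + t₂) • (1 : Module.End ℂ V) ∧
          ∑ a : Fin 2, ∑ b : Fin 2, R (Matrix.single a b 1) * R (Matrix.single b a 1) =
            (t₁ ^ 2 + t₂ ^ 2 - 1 / 2) • (1 : Module.End ℂ V)))
    (hC3 : ∀ {K : Type} [Field K] [NumberField K] {hcpt : isCompact_glFiniteIntegralLevel 2 K}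
      (π : AutomorphicRepData (AutomorphyDatum.gl 2 K hcpt))
      {ρ𝔤 : (AutomorphyDatum.gl 2 K hcpt).arch.lie →ₗ⁅ℝ⁆ Module.End ℂ π.Quot}, π.HasLieAction ρ𝔤 →
      ∀ w : {w : InfinitePlace K // w.IsComplex},
      (∀ v : π.Quot, ∃ F : Submodule ℂ π.Quot, v ∈ F ∧ FiniteDimensional ℂ F ∧
          ∀ Y : Matrix (Fin 2) (Fin 2) ℂ, Yᴴ = -Y → ∀ x ∈ F,
            (ρ𝔤.comp (LieSubalgebra.topEquiv : (⊤ : LieSubalgebra ℝ (Matrix (Fin 2) (Fin 2) (mixedSpace K)))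
                ≃ₗ⁅ℝ⁆ Matrix (Fin 2) (Fin 2) (mixedSpace K)).symm.toLieHom).comp (complexPlaceLie 2 w) Y x ∈ F) ∧
        (∀ (j : Fin 2) (μ : ℂ) (v : π.Quot), v ≠ 0 →
          (ρ𝔤.comp (LieSubalgebra.topEquiv : (⊤ : LieSubalgebra ℝ (Matrix (Fin 2) (Fin 2) (mixedSpace K)))
              ≃ₗ⁅ℝ⁆ Matrix (Fin 2) (Fin 2) (mixedSpace K)).symm.toLieHom).comp (complexPlaceLie 2 w)
            (Complex.I • Matrix.single j j (1 : ℂ)) v = μ • v → ∃ k : ℤ, μ = k * Complex.I))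
    {K : Type} [Field K] [NumberField K] {hcpt : isCompact_glFiniteIntegralLevel 2 K}
    (π : AutomorphicRepData (AutomorphyDatum.gl 2 K hcpt)) (χ : (K →+* ℂ) → Multiset ℂ)
    (hχ : π.HasArchParameter χ) (w : {w : InfinitePlace K // w.IsComplex}) :
    ∃ a₁ a₂ b₁ b₂ : ℂ,
      χ w.1.embedding = {a₁, a₂} ∧ χ (ComplexEmbedding.conjugate w.1.embedding) = {b₁, b₂} ∧
      (∃ k : ℤ, a₁ - b₁ = k) ∧ (∃ l : ℤ, a₂ - b₂ = l) := by
  obtain ⟨ρ𝔤, hρ, -, hco⟩ := hχ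
  -- the restriction `ρ_w` to `𝔤𝔩₂(ℂ) = 𝔤𝔩₂(K_w)` has Harish-Chandra parameter `τ ↦ χ(τ ∘ σ_w)`
  have hw := hco w
  -- the two multisets
  obtain ⟨s₁, s₂, hs⟩ : ∃ s₁ s₂ : ℂ, χ w.1.embedding = {s₁, s₂} := by
    have h1 := card_eq_of_hasHCParameter _ hw (AlgHom.id ℝ ℂ)
    rw [algHomId_toRingHom_comp] at h1
    exact Multiset.card_eq_two.mp h1
  obtain ⟨t₁, t₂, ht⟩ : ∃ t₁ t₂ : ℂ, χ (ComplexEmbedding.conjugate w.1.embedding) = {t₁, t₂} := by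
    have h1 := card_eq_of_hasHCParameter _ hw (Complex.conjAe : ℂ →ₐ[ℝ] ℂ)
    rw [conjAe_toRingHom_comp] at h1
    exact Multiset.card_eq_two.mp h1
  -- the factorisation (C2)
  obtain ⟨L, R, hLR, hρLR, hL, hR⟩ := hC2 _ _ hw
  obtain ⟨hZL, hCL⟩ := hL s₁ s₂ (by rw [algHomId_toRingHom_comp, hs])
  obtain ⟨hZR, hCR⟩ := hR t₁ t₂ (by rw [conjAe_toRingHom_comp, ht])
  -- local finiteness and torus integrality (C3)
  obtain ⟨hfin, hint⟩ := hC3 π hρ w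
  -- C1
  haveI : Nontrivial π.Quot := π.nontrivial_quot
  have key := hC1 (V := π.Quot) L R hLR s₁ s₂ t₁ t₂ hZL hCL hZR hCR
    (fun v => by
      obtain ⟨F, hvF, hFfin, hFst⟩ := hfin v
      refine ⟨F, hvF, hFfin, fun Y hY x hx => ?_⟩
      have h1 := hFst Y hY x hx
      rw [hρLR Y, map_conj_eq_neg_transpose_of_skew hY, map_neg, ← sub_eq_add_neg] at h1
      exact h1)
    (fun j μ v hv hμ => by
      have h2 : (Complex.I • L (Matrix.single j j 1) - Complex.I • R (Matrix.single j j 1)) v =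
          (Complex.I * μ) • v := by
        have t : (Complex.I • L (Matrix.single j j 1) - Complex.I • R (Matrix.single j j 1)) v =
            Complex.I • ((L (Matrix.single j j 1) - R (Matrix.single j j 1)) v) := by
          rw [LinearMap.sub_apply, LinearMap.sub_apply, smul_sub]; rfl
        rw [t, hμ, smul_smul]
      have hIskew : (Complex.I • Matrix.single j j (1 : ℂ))ᴴ = -(Complex.I • Matrix.single j j (1 : ℂ)) := by
        rw [Matrix.conjTranspose_smul, Matrix.conjTranspose_single, star_one, Complex.star_def,
          Complex.conj_I, neg_smul]
      have h1 := hint j (Complex.I * μ) v hv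
      rw [hρLR (Complex.I • Matrix.single j j 1), map_conj_eq_neg_transpose_of_skew hIskew, map_neg,
        ← sub_eq_add_neg, Matrix.transpose_smul, Matrix.transpose_single,
        map_smul L Complex.I (Matrix.single j j (1 : ℂ)), map_smul R Complex.I (Matrix.single j j (1 : ℂ))] at h1
      obtain ⟨k, hk⟩ := h1 h2
      refine ⟨k, mul_right_cancel₀ Complex.I_ne_zero ?_⟩
      rw [mul_comm]; exact hk)
  rcases key with ⟨k, l, hk, hl⟩ | ⟨k, l, hk, hl⟩
  · exact ⟨s₁, s₂, t₁, t₂, hs, ht, ⟨k, hk⟩, ⟨l, hl⟩⟩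
  · refine ⟨s₁, s₂, t₂, t₁, hs, ?_, ⟨k, hk⟩, ⟨l, hl⟩⟩
    rw [ht, Multiset.pair_comm]

end Summit.Langlands.Langlands.Theorems.RegularTwistCM

end
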